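import Mathlib
import Summits.PneNP.PneNP.Theses.OneSlice
import Summits.PneNP.PneNP.Theorems.OneSliceSliceTargetSplit
import Summits.PneNP.PneNP.Theorems.OneSliceSliceTargetSplitStability
import Summits.PneNP.PneNP.Theorems.OneSliceMonotoneContinuationDefs
import Summits.PneNP.PneNP.Theorems.OneSliceMonotoneContinuationWindow

/-!
# Route OneSlice, crux `MonotoneContinuation` (stmt-PneNP-18471), line `Sketch_ideator1_r1` — bridge `MC → flat-below`,
part 5: small facts for the deletion assembly

`bridgeD_natfacts`, `bridgeD_accounting`, `bridgeD_realfacts` (from `A = m^{1/4} ≥ 40(L+1)` and `A ≥ 6000/η`) and the eventual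
facts `eventually_bridgeD`, each in a clean context.
-/

set_option linter.dupNamespace false -- `Summit.PneNP.PneNP.…`: summit = sub-problem (D-0017)

namespace Summit.PneNP.PneNP.Theorems.MonotoneContinuation

open Literature.Computability.Complexity hiding supp mem_supp
open Finset hiding slice
open Filter hiding mem_sdiff
open Classical
open Summit.PneNP.PneNP.Theorems (card_slice binomialWeight_tail_le binomialWeight_nonneg)
open Summit.PneNP.PneNP.Theorems.ConstantBand.Negative (Edge thr Central slice)
open Summit.PneNP.PneNP.Theorems.SingleThreshold.Negative (pc tendsto_pc)
open Summit.PneNP.PneNP.Theorems.SliceACZero.Negative (supp mem_supp card_supp)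
open Summit.PneNP.PneNP.Theorems.SliceTargetSplit (nbhd mem_nbhd transport ind l1 card_nbhd_of_le card_nbhd_of_ge comp_iff_supp
  transport_ind_mem ind_nonneg ind_le_one l1_triangle l1_nonneg transport_nonneg rdist_eq_l1)

noncomputable section

variable {n : ℕ}

/-! ## Part 6 — small facts for the deletion assembly (clean contexts) -/

/-- Natural-number facts of the deletion bridge: `⌊√j⌋ ≤ 2⌊√m⌋` and `L⌊√j⌋ + 2 ≤ j` for `j ∈ [m, m + D]`. -/
theorem bridgeD_natfacts {L m j D : ℕ} (hq : 8 ≤ Nat.sqrt m) (hmj : m ≤ j) (hjD : j ≤ m + D)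
    (hDm : (D + 4 * Nat.sqrt m + 3) * (4 * L + 2) ≤ m) :
    Nat.sqrt j ≤ 2 * Nat.sqrt m ∧ L * Nat.sqrt j + 2 ≤ j := by
  set q := Nat.sqrt m with hqdef
  have hqq : q * q ≤ m := Nat.sqrt_le m
  have hmq : m < (q + 1) * (q + 1) := Nat.lt_succ_sqrt m
  have hD : D ≤ m := by nlinarith
  have hLq : 16 * L * q ≤ m := by nlinarith
  have hj2 : j < (2 * q + 1) ^ 2 := by nlinarith
  have hsj : Nat.sqrt j ≤ 2 * q := Nat.le_of_lt_succ (Nat.sqrt_lt'.2 hj2)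
  refine ⟨hsj, ?_⟩
  have h1 : L * Nat.sqrt j ≤ L * (2 * q) := Nat.mul_le_mul_left L hsj
  have h64 : 8 * 8 ≤ q * q := Nat.mul_le_mul hq hq
  nlinarith

/-- Final accounting of the deletion bridge, in a clean context. -/
theorem bridgeD_accounting {η cb c₀ ε ηMC δt t : ℝ} (hη : 0 < η) (hcb : 0 < cb) (hc₀ : 0 < c₀)
    (hηMC : ηMC = η * cb / 2560) (hε : ε ≤ η * c₀ / 6400) (hδt : δt ≤ η / 2240) (ht : 4 / t ≤ η / 16) :
    2 * (4 / t + 6 * (8 / cb * ηMC + 10 * (ε / c₀) + 7 / 2 * δt)) ≤ η / 5 ∧ 2 * (ε / c₀) + 2 * (η / 5) ≤ η := by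
  have h1 : 8 / cb * ηMC = η / 320 := by rw [hηMC]; field_simp; ring
  have h2 : ε / c₀ ≤ η / 6400 := by rw [div_le_iff₀ hc₀]; linarith
  constructor
  · rw [h1]; linarith
  · linarith

/-- Real-number facts of the deletion bridge at one `n`, from `A := m^{1/4} ≥ 40(L+1)` and `A ≥ 6000/η`. -/
theorem bridgeD_realfacts {p η A : ℝ} {m N L D : ℕ} (hη : 0 < η) (hmμ : (m : ℝ) ≤ (N : ℝ) * p) (hp8 : p ≤ 1 / 8)
    (hA0 : 0 ≤ A) (hmA : (m : ℝ) = A ^ 4) (hD : (D : ℝ) ≤ A ^ 3) (hAL : 40 * ((L : ℝ) + 1) ≤ A) (hAη : 6000 / η ≤ A) :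
    8 ≤ Nat.sqrt m ∧ 40 * ((L : ℝ) + 3) ≤ Real.sqrt m ∧ (D + 4 * Nat.sqrt m + 3) * (4 * L + 2) ≤ m ∧
      (2 * L + 6) * Nat.sqrt m ≤ m ∧ 8 * m ≤ N ∧ 2 * ((D : ℝ) + 4 * Nat.sqrt m + 3) / m ≤ η / 2240 := by
  set q := Nat.sqrt m with hqdef
  have hL0 : (0 : ℝ) ≤ L := Nat.cast_nonneg _
  have hA40 : (40 : ℝ) ≤ A := by nlinarith
  have hA1 : (1 : ℝ) ≤ A := by linarith
  have hsqrt : Real.sqrt m = A ^ 2 := by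
    rw [hmA, show (A ^ 4 : ℝ) = (A ^ 2) ^ 2 by ring, Real.sqrt_sq (by positivity)]
  have hqq : q * q ≤ m := Nat.sqrt_le m
  have hqr : (q : ℝ) ≤ A ^ 2 := by
    rw [← hsqrt]; exact Real.le_sqrt_of_sq_le (by exact_mod_cast (show q ^ 2 ≤ m by nlinarith))
  have hq0 : (0 : ℝ) ≤ q := Nat.cast_nonneg _
  have hA2 : A ^ 2 ≤ A ^ 3 / 40 := by nlinarith [pow_pos (by linarith : (0 : ℝ) < A) 2]
  have hA3 : A ^ 3 ≤ A ^ 4 / 40 := by nlinarith [pow_pos (by linarith : (0 : ℝ) < A) 3]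
  have hm64 : (64 : ℝ) ≤ m := by rw [hmA]; nlinarith
  refine ⟨?_, ?_, ?_, ?_, ?_, ?_⟩
  · rw [hqdef, Nat.le_sqrt]
    exact_mod_cast (show (64 : ℝ) ≤ m from hm64)
  · rw [hsqrt]; nlinarith
  · -- `(D + 4q + 3)(4L + 2) ≤ (A³ + 4A² + 3) · A/10 ≤ A⁴ = m`
    have h1 : ((D : ℝ) + 4 * q + 3) ≤ A ^ 3 + 4 * A ^ 2 + 3 := by linarith
    have h2 : (4 * (L : ℝ) + 2) ≤ A / 10 := by linarith
    have h3 : ((D : ℝ) + 4 * q + 3) * (4 * L + 2) ≤ (A ^ 3 + 4 * A ^ 2 + 3) * (A / 10) :=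
      mul_le_mul h1 h2 (by positivity) (by positivity)
    have h4 : (A ^ 3 + 4 * A ^ 2 + 3) * (A / 10) ≤ A ^ 4 := by nlinarith
    have : (((D + 4 * q + 3) * (4 * L + 2) : ℕ) : ℝ) ≤ m := by push_cast; rw [hmA]; linarith
    exact_mod_cast this
  · have h1 : (2 * (L : ℝ) + 6) * q ≤ (2 * L + 6) * A ^ 2 := mul_le_mul_of_nonneg_left hqr (by positivity)
    have h2 : (2 * (L : ℝ) + 6) * A ^ 2 ≤ A ^ 4 := by
      have : (2 * (L : ℝ) + 6) ≤ A ^ 2 := by nlinarith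
      nlinarith [pow_pos (by linarith : (0 : ℝ) < A) 2]
    have : (((2 * L + 6) * q : ℕ) : ℝ) ≤ m := by push_cast; rw [hmA]; linarith
    exact_mod_cast this
  · have h1 : (N : ℝ) * p ≤ N * (1 / 8) := mul_le_mul_of_nonneg_left hp8 (Nat.cast_nonneg _)
    have : ((8 * m : ℕ) : ℝ) ≤ N := by push_cast; linarith
    exact_mod_cast this
  · -- `2(D + 4q + 3)/m ≤ 2·(1.2 A³)/A⁴ = 2.4/A ≤ η/2240`
    have hm0 : (0 : ℝ) < m := by linarith
    rw [div_le_div_iff₀ hm0 (by norm_num : (0 : ℝ) < 2240), hmA]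
    have h1 : ((D : ℝ) + 4 * q + 3) ≤ 6 / 5 * A ^ 3 := by nlinarith
    have hAη' : 6000 ≤ A * η := by rwa [div_le_iff₀ hη] at hAη
    nlinarith [pow_pos (by linarith : (0 : ℝ) < A) 3, mul_le_mul_of_nonneg_left hAη' (show 0 ≤ A ^ 3 by positivity)]

/-- **Eventual facts for the deletion bridge.** -/
theorem eventually_bridgeD {k : ℕ} (hk : 3 ≤ k) (M₀ B : ℝ) :
    ∀ᶠ n : ℕ in atTop, 0 < pc n k ∧ pc n k ≤ 1 / 8 ∧ 2 ≤ n ∧ M₀ ≤ ((n.choose 2 : ℕ) : ℝ) * pc n k ∧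
      B ≤ (thr k n : ℝ) ^ ((1 : ℝ) / 4) ∧
      ∀ j : ℕ, Central k n j → 1 ≤ j ∧ j ≤ n.choose 2 ∧ j ≤ thr k n + ⌊(thr k n : ℝ) ^ ((3 : ℝ) / 4)⌋₊ := by
  have hμ := tendsto_mean hk
  have hm : Tendsto (fun n : ℕ => (thr k n : ℝ)) atTop atTop :=
    tendsto_natCast_atTop_atTop.comp (tendsto_nat_floor_atTop.comp hμ)
  have hA : Tendsto (fun n : ℕ => (thr k n : ℝ) ^ ((1 : ℝ) / 4)) atTop atTop :=
    (tendsto_rpow_atTop (by norm_num)).comp hm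
  filter_upwards [eventually_central hk 0, eventually_ge_atTop 2, hμ.eventually_ge_atTop M₀, hA.eventually_ge_atTop B]
    with n hcen hn2 hM₀ hB
  obtain ⟨hp0, hp8, hj⟩ := hcen
  refine ⟨hp0, hp8, hn2, hM₀, hB, fun j hjc => ⟨by have := (hj j hjc).2.1; omega, (hj j hjc).1, ?_⟩⟩
  have h1 := (abs_le.1 hjc).2
  have h2 := Nat.lt_floor_add_one ((thr k n : ℝ) ^ ((3 : ℝ) / 4))
  have : (j : ℝ) < (thr k n : ℝ) + ⌊(thr k n : ℝ) ^ ((3 : ℝ) / 4)⌋₊ + 1 := by linarith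
  exact_mod_cast Nat.lt_succ_iff.1 (by exact_mod_cast this)


/-! ## Registered form -/

/-- **Natural-number facts of the deletion bridge** (registered sub-goal `bridgeDNatfacts` of stmt-PneNP-18471), written out. [folklore] -/
theorem bridgeDNatfacts :
  ∀ (L m j D : ℕ), 8 ≤ Nat.sqrt m → m ≤ j → j ≤ m + D → (D + 4 * Nat.sqrt m + 3) * (4 * L + 2) ≤ m →
    Nat.sqrt j ≤ 2 * Nat.sqrt m ∧ L * Nat.sqrt j + 2 ≤ j :=
  fun _ _ _ _ hq hmj hjD hDm => bridgeD_natfacts hq hmj hjD hDm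

end

end Summit.PneNP.PneNP.Theorems.MonotoneContinuation
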